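/-
Copyright: the b2b-balaban cell (near-miss cell 7), T⁴-continuum CRUX team (coordinator ruling e34b3e0c item (2)),
seat t4-ne7b-formalise-leaf-06 (gen 27). Released under the licence of the surrounding project.
-/
import Literature.MathematicalPhysics.QuantumFieldTheory.Sweep1
import HarnessLib

/-!
# The abelian Dirichlet rung: discrete maximum principle for the curvature of a critical abelian lattice field
# (route NE7b R-H, `t4/ROUTES-NE7b.md` v4 §2 item (2b) — the abelian model of PH-c⁺ «no overshoot»)

Cell `pub-balaban`, sub-cell `t4`, spine estimate NE7b (node U5c), candidate route R-H «Peierls healing map»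
(`t4/ROUTES-NE7b.md` v4, seat `t4-ne7b-idea-1`). After the refuter's F13 (context-free one-cube small-field extension is
FALSE; kernel: `Spine/NE7b/SmallFieldExtensionNoGo.lean`) the route's one new local lemma is PH-c⁺ («margin /
interior-regularity of the healed branch's MINIMISERS: no overshoot on the look-in cubes»). v4 §2 (2b) names its
abelian, law-free model — «ABELIAN DIRICHLET RUNG [K; linear algebra, provable now]»:

  for the toy «minimise `Σ_p (dA)_p²` over the links of a region with the exterior links frozen», the Euler–Lagrange
  equations `δF = 0` on interior links together with `dF = 0` make every component `F_{μν}` of the minimiser's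
  curvature lattice-harmonic at each plaquette whose four links are interior, so `max_I |F_{μν}| ≤ max_{∂I} |F_{μν}|`
  with constant EXACTLY 1, uniformly in the size and shape of the region (discrete maximum principle).

THIS FILE PROVES (2b) on `ℤ^d`, every `d ≥ 1`, for real link fields `A : ZdEdge d → ℝ` (non-compact abelian toy):

* `curv A x μ ν = A(x,μ) + A(x+e_μ,ν) − A(x+e_ν,μ) − A(x,ν)` (`F = dA`), `codiff A y ν = Σ_λ (F_{λν}(y) − F_{λν}(y−e_λ))`
  (`δF`); **`laplacian_curv`** — the flat discrete Weitzenböck identity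
  `Σ_λ [F_{μν}(x+e_λ) − 2F_{μν}(x) + F_{μν}(x−e_λ)] = (δF)_ν(x+e_μ) − (δF)_ν(x) − (δF)_μ(x+e_ν) + (δF)_μ(x)` (= `(dδF)_{μν}(x)`;
  `δdF = 0` because `F` is exact), proved termwise in `λ` as `∇⁻_λ`(Bianchi) by `ring`;
* **`meanValue_curv`** — if `δF` vanishes on the four links of the plaquette `(x; μ, ν)` then
  `2d·F_{μν}(x) = Σ_λ (F_{μν}(x+e_λ) + F_{μν}(x−e_λ))` (lattice-harmonic at `x`);
* **`codiff_eq_zero_of_isMinOn`** — the Euler–Lagrange equation: if moving the single link value `A(b)` cannot lower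
  the energy of the `2(d−1)` plaquettes through `b` (equivalently: of any finite family of plaquettes containing them,
  the others being independent of `A(b)`), then `(δF)(b) = 0`;
* **`exists_mem_layer_le_of_harmonic`** — the discrete maximum principle for a function lattice-harmonic on a finite
  set `I` of sites: its values on `I` are bounded by its values on the outer layer `layer I = {x ± e_λ : x ∈ I} \ I`;
* **`abelianDirichletRung`** / **`abelianDirichletRung_abs`** — for every finite `I` such that `δF = 0` on the four
  links of `(x; μ, ν)` for all `x ∈ I`: `∀ x ∈ I, ∃ y ∈ layer I, |F_{μν}(x)| ≤ |F_{μν}(y)|`. Each `y ∈ layer I` labels a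
  same-orientation translate of an `I`-plaquette one step away (in the toy: it touches a frozen link, so its value is
  CERTIFIED by the common exterior data) — F15's «reversed gain» cannot occur in this model, a collar ONE plaquette deep
  suffices, and no margin is lost (factor `1`); **`abelianDirichletRung_free`** packages this for a finite set `free` of
  links (`I = freePlaq free μ ν`, every `y ∈ layer I` labels a plaquette with a frozen link).

HONEST FRAMING. The abelian, non-compact, Dirichlet (link-frozen) TOY only — (2b) verbatim. v4 §2 (2c) lists what
changes for Bałaban's SU(2), d = 4 problem (block-average constraints put Lagrange sources on every block: NO exact
maximum principle, replaced by pseudo-locality of the linearised background operator, CMP 102 (63)–(73), Prop. 4;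
curved background; the look-in geometry on the M1 carrier) — none of it is touched here. Nothing of [Bałaban 1983–89]
is asserted. PH-c⁺ is OPEN. NE7b (`T4WeightBudget.RelWeightBound`) is NOT PRINTED and NOT PROVED; spine PROVED 0∕9;
rung (B)+1 on a FINITE torus T⁴ — NOT infinite volume, NOT the mass gap, NOT Clay. HONEST DEPENDENCY: continuum YM on
T⁴ ⇐ BetaPertH ∧ nine spine estimates (0/9 proved); BetaPertH ⇐ (D1) ∧ (D4) ∧ CAP+tail; G-an2-4 gates asym, D1 and
NE2/3/4. POLICY: crux-route work under `Spine/NE7b/`; not a `T4Continuum/Support` leaf (FREEZE (0) respected); no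
`Prop`-valued fact, no `[cite:]` fact: definitions are the toy's objects (`curv`, `codiff`, `localEnergy`, `layer`).
-/

set_option autoImplicit false

noncomputable section

namespace Summit.QuantumFields.BalabanUV.T4Continuum.NE7b.AbelianCurvatureMaximumPrinciple

open Finset
open scoped BigOperators
open Literature.MathematicalPhysics.QuantumFieldTheory (ZdEdge)
open Literature.Probability.LatticeModels (Site)

variable {d : ℕ}

/-! ## §1 Exterior calculus of the toy: `F = dA`, `δF`, and the flat Weitzenböck identity -/

/-- The unit lattice vector `e_λ ∈ ℤ^d`. -/
def e (l : Fin d) : Site d := Pi.single l 1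

/-- Abelian curvature `F_{μν}(x) = (dA)_{μν}(x) = A_μ(x) + A_ν(x+e_μ) − A_μ(x+e_ν) − A_ν(x)` of a real link field
(same link pattern as `ZdGaugeConfig.plaquette`). -/
def curv (A : ZdEdge d → ℝ) (x : Site d) (μ ν : Fin d) : ℝ :=
  A (x, μ) + A (x + e μ, ν) - A (x + e ν, μ) - A (x, ν)

/-- The codifferential of the curvature on the link `(y, ν)`: `(δF)_ν(y) = Σ_λ (F_{λν}(y) − F_{λν}(y − e_λ))`, the sum
of `F` over the `2(d−1)` plaquettes through the link with their incidence signs (the `λ = ν` term vanishes). -/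
def codiff (A : ZdEdge d → ℝ) (y : Site d) (ν : Fin d) : ℝ :=
  ∑ l : Fin d, (curv A y l ν - curv A (y - e l) l ν)

/-- `F` is antisymmetric. -/
theorem curv_swap (A : ZdEdge d → ℝ) (x : Site d) (μ ν : Fin d) : curv A x ν μ = -curv A x μ ν := by
  unfold curv; ring

/-- Degenerate labels: `F_{νν} = 0`. -/
theorem curv_self (A : ZdEdge d → ℝ) (x : Site d) (ν : Fin d) : curv A x ν ν = 0 := by
  unfold curv; ring

/-- Termwise Weitzenböck: `∇⁻_λ∇⁺_λ F_{μν} = ∇⁻_λ(∇⁺_μ F_{λν} + ∇⁺_ν F_{μλ})` at `x` — the backward difference of the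
Bianchi identity `dF = 0`, an identity between values of `A`. -/
theorem laplacian_curv_term (A : ZdEdge d → ℝ) (x : Site d) (μ ν l : Fin d) :
    curv A (x + e l) μ ν - 2 * curv A x μ ν + curv A (x - e l) μ ν =
      (curv A (x + e μ) l ν - curv A (x + e μ - e l) l ν) - (curv A x l ν - curv A (x - e l) l ν)
        - (curv A (x + e ν) l μ - curv A (x + e ν - e l) l μ) + (curv A x l μ - curv A (x - e l) l μ) := by
  simp only [curv]
  ring_nf

/-- **The flat discrete Weitzenböck identity** `(−ΔF)_{μν}(x) = (dδF)_{μν}(x)` for `F = dA` on `ℤ^d`: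
`Σ_λ [F_{μν}(x+e_λ) − 2F_{μν}(x) + F_{μν}(x−e_λ)] = (δF)_ν(x+e_μ) − (δF)_ν(x) − (δF)_μ(x+e_ν) + (δF)_μ(x)` — the Hodge
Laplacian `dδ + δd` of the cubic lattice acts componentwise as the nearest-neighbour Laplacian, and `δdF = δddA = 0`. -/
theorem laplacian_curv (A : ZdEdge d → ℝ) (x : Site d) (μ ν : Fin d) :
    ∑ l : Fin d, (curv A (x + e l) μ ν - 2 * curv A x μ ν + curv A (x - e l) μ ν) =
      codiff A (x + e μ) ν - codiff A x ν - codiff A (x + e ν) μ + codiff A x μ := by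
  simp only [codiff, ← Finset.sum_sub_distrib, ← Finset.sum_add_distrib]
  exact Finset.sum_congr rfl fun l _ => laplacian_curv_term A x μ ν l

/-- **Harmonicity at a free plaquette.** If `δF` vanishes on the four links `(x,μ), (x+e_μ,ν), (x+e_ν,μ), (x,ν)` of the
plaquette `(x; μ, ν)` (the Euler–Lagrange equations there), then `F_{μν}` has the lattice MEAN-VALUE property at `x`:
`2d · F_{μν}(x) = Σ_λ (F_{μν}(x + e_λ) + F_{μν}(x − e_λ))`. -/
theorem meanValue_curv (A : ZdEdge d → ℝ) (x : Site d) (μ ν : Fin d)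
    (h₁ : codiff A x μ = 0) (h₂ : codiff A (x + e μ) ν = 0) (h₃ : codiff A (x + e ν) μ = 0) (h₄ : codiff A x ν = 0) :
    2 * (d : ℝ) * curv A x μ ν = ∑ l : Fin d, (curv A (x + e l) μ ν + curv A (x - e l) μ ν) := by
  have h := laplacian_curv A x μ ν
  rw [h₁, h₂, h₃, h₄] at h
  simp only [add_zero, sub_self] at h
  have hs : ∑ l : Fin d, (curv A (x + e l) μ ν - 2 * curv A x μ ν + curv A (x - e l) μ ν) =
      ∑ l : Fin d, (curv A (x + e l) μ ν + curv A (x - e l) μ ν) - 2 * (d : ℝ) * curv A x μ ν := by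
    rw [Finset.sum_congr rfl fun l _ => show curv A (x + e l) μ ν - 2 * curv A x μ ν + curv A (x - e l) μ ν =
        (curv A (x + e l) μ ν + curv A (x - e l) μ ν) - 2 * curv A x μ ν by ring,
      Finset.sum_sub_distrib, Finset.sum_const, Finset.card_univ, Fintype.card_fin, nsmul_eq_mul]
    ring
  linarith

/-! ## §2 The Euler–Lagrange equation of the Dirichlet toy on one link -/

/-- The energy of the `2(d−1)` plaquettes through the link `(y, ν)` (orientations `(λ, ν)`, `λ ≠ ν`; the `λ = ν` terms
are `0`): the only part of the Dirichlet energy `Σ_p (dA)_p²` that depends on the link value `A(y, ν)`. -/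
def localEnergy (A : ZdEdge d → ℝ) (y : Site d) (ν : Fin d) : ℝ :=
  ∑ l : Fin d, (curv A y l ν ^ 2 + curv A (y - e l) l ν ^ 2)

/-- Moving the single link value `A(y,ν) ↦ A(y,ν) + t`. -/
def shiftLink (A : ZdEdge d → ℝ) (y : Site d) (ν : Fin d) (t : ℝ) : ZdEdge d → ℝ :=
  Function.update A (y, ν) (A (y, ν) + t)

/-- `e_λ ≠ 0`. -/
theorem e_ne_zero (l : Fin d) : (e l : Site d) ≠ 0 := by
  intro h
  have := congrFun h l
  simp [e] at this

/-- Effect of the one-link shift on the plaquettes through the link: for `λ ≠ ν`, `F_{λν}(y) ↦ F_{λν}(y) − t` and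
`F_{λν}(y − e_λ) ↦ F_{λν}(y − e_λ) + t`. -/
theorem curv_shiftLink (A : ZdEdge d → ℝ) (y : Site d) (ν l : Fin d) (t : ℝ) (hl : l ≠ ν) :
    curv (shiftLink A y ν t) y l ν = curv A y l ν - t ∧
      curv (shiftLink A y ν t) (y - e l) l ν = curv A (y - e l) l ν + t := by
  have hne1 : ((y, l) : ZdEdge d) ≠ (y, ν) := by simp [hl]
  have hne2 : ((y + e l, ν) : ZdEdge d) ≠ (y, ν) := by simp [e_ne_zero]
  have hne3 : ((y + e ν, l) : ZdEdge d) ≠ (y, ν) := by simp [hl]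
  have hne4 : ((y - e l, l) : ZdEdge d) ≠ (y, ν) := by simp [hl]
  have hne5 : ((y - e l + e ν, l) : ZdEdge d) ≠ (y, ν) := by simp [hl]
  have hne6 : ((y - e l, ν) : ZdEdge d) ≠ (y, ν) := by simp [e_ne_zero, sub_eq_add_neg]
  have he : y - e l + e l = y := sub_add_cancel y (e l)
  constructor
  · simp only [curv, shiftLink, Function.update_of_ne hne1, Function.update_of_ne hne2, Function.update_of_ne hne3,
      Function.update_self]
    ring
  · simp only [curv, shiftLink, he, Function.update_of_ne hne4, Function.update_of_ne hne5, Function.update_of_ne hne6,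
      Function.update_self]
    ring

/-- The local energy along the one-link shift is the parabola `E(t) = E(0) − 2t·(δF)_ν(y) + 2(d−1)t²`. -/
theorem localEnergy_shiftLink (A : ZdEdge d → ℝ) (y : Site d) (ν : Fin d) (t : ℝ) :
    localEnergy (shiftLink A y ν t) y ν =
      localEnergy A y ν - 2 * t * codiff A y ν + 2 * ((d : ℝ) - 1) * t ^ 2 := by
  unfold localEnergy codiff
  have hsplit : ∀ (g : Fin d → ℝ), ∑ l, g l = g ν + ∑ l ∈ univ.erase ν, g l :=
    fun g => (Finset.add_sum_erase _ g (mem_univ ν)).symm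
  rw [hsplit, hsplit (fun l => curv A y l ν ^ 2 + curv A (y - e l) l ν ^ 2),
    hsplit (fun l => curv A y l ν - curv A (y - e l) l ν)]
  simp only [curv_self, sub_self, zero_pow two_ne_zero, add_zero, zero_add]
  have hcard : ((univ.erase ν).card : ℝ) = (d : ℝ) - 1 := by
    rw [Finset.card_erase_of_mem (mem_univ ν), Finset.card_univ, Fintype.card_fin, Nat.cast_sub, Nat.cast_one]
    exact Fin.pos ν
  have hterm : ∀ l ∈ univ.erase ν, curv (shiftLink A y ν t) y l ν ^ 2 + curv (shiftLink A y ν t) (y - e l) l ν ^ 2 =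
      (curv A y l ν ^ 2 + curv A (y - e l) l ν ^ 2) - 2 * t * (curv A y l ν - curv A (y - e l) l ν) + 2 * t ^ 2 := by
    intro l hl
    obtain ⟨h1, h2⟩ := curv_shiftLink A y ν l t (Finset.ne_of_mem_erase hl)
    rw [h1, h2]; ring
  rw [Finset.sum_congr rfl hterm, Finset.sum_add_distrib, Finset.sum_sub_distrib, Finset.sum_const, ← Finset.mul_sum,
    nsmul_eq_mul, hcard]
  ring

/-- **Euler–Lagrange on one link.** If the link value `A(y, ν)` is optimal for the energy of the plaquettes through it —
no shift `t` lowers `localEnergy` (equivalently: `A` minimises the Dirichlet energy of any region in the direction of this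
free link, all other plaquettes being independent of `A(y,ν)`) — then `(δF)_ν(y) = 0`. -/
theorem codiff_eq_zero_of_isMinOn (A : ZdEdge d → ℝ) (y : Site d) (ν : Fin d)
    (hmin : ∀ t : ℝ, localEnergy A y ν ≤ localEnergy (shiftLink A y ν t) y ν) : codiff A y ν = 0 := by
  set c := codiff A y ν with hc
  set D := 2 * ((d : ℝ) - 1) with hD
  have hD0 : 0 ≤ D := by
    have : (1 : ℝ) ≤ d := by exact_mod_cast Fin.pos ν
    rw [hD]; linarith
  -- the parabola `−2tc + D t²` is `≥ 0` for all `t`; test it at `t = c / (D + 1)`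
  have key : ∀ t : ℝ, 0 ≤ -2 * t * c + D * t ^ 2 := by
    intro t; have h := hmin t; rw [localEnergy_shiftLink] at h; linarith
  have hD1 : 0 < D + 1 := by linarith
  have h := key (c / (D + 1))
  have h' : -2 * (c / (D + 1)) * c + D * (c / (D + 1)) ^ 2 = -(c ^ 2 * (D + 2)) / (D + 1) ^ 2 := by
    field_simp; ring
  rw [h'] at h
  have hnum : 0 ≤ -(c ^ 2 * (D + 2)) := by
    have := mul_nonneg h (le_of_lt (by positivity : (0 : ℝ) < (D + 1) ^ 2))
    rwa [div_mul_cancel₀ _ (by positivity : ((D + 1) ^ 2 : ℝ) ≠ 0)] at this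
  nlinarith [sq_nonneg c]

/-! ## §3 The discrete maximum principle -/

/-- The outer layer of a finite set of sites: nearest neighbours of `I` not in `I`. -/
def layer (I : Finset (Site d)) : Finset (Site d) :=
  (I.biUnion fun x => univ.biUnion fun l : Fin d => ({x + e l, x - e l} : Finset (Site d))) \ I

/-- Neighbours of `I` outside `I` are in the layer. -/
theorem mem_layer_of_not_mem {I : Finset (Site d)} {x : Site d} (hx : x ∈ I) (l : Fin d) :
    (x + e l ∉ I → x + e l ∈ layer I) ∧ (x - e l ∉ I → x - e l ∈ layer I) := by
  constructor <;> intro h <;> simp only [layer, mem_sdiff, mem_biUnion, mem_univ, true_and, mem_insert, mem_singleton] <;>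
    exact ⟨⟨x, hx, l, by simp⟩, h⟩

/-- A lattice-harmonic function at a maximum point of `I ∪ layer I` lying in `I` is constant on the neighbours. -/
theorem eq_of_harmonic_max {f : Site d → ℝ} {I : Finset (Site d)} {x : Site d} {M : ℝ} (hx : x ∈ I)
    (hharm : 2 * (d : ℝ) * f x = ∑ l : Fin d, (f (x + e l) + f (x - e l)))
    (hmax : ∀ y ∈ I ∪ layer I, f y ≤ M) (hfx : f x = M) (l : Fin d) : f (x + e l) = M ∧ f (x - e l) = M := by
  have hnb : ∀ l' : Fin d, f (x + e l') ≤ M ∧ f (x - e l') ≤ M := by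
    intro l'
    obtain ⟨hp, hm⟩ := mem_layer_of_not_mem hx l'
    constructor
    · by_cases h : x + e l' ∈ I
      · exact hmax _ (mem_union_left _ h)
      · exact hmax _ (mem_union_right _ (hp h))
    · by_cases h : x - e l' ∈ I
      · exact hmax _ (mem_union_left _ h)
      · exact hmax _ (mem_union_right _ (hm h))
  -- sum of `2d` terms each `≤ M` equals `2d·M`
  have hsum : ∑ l' : Fin d, (f (x + e l') + f (x - e l')) = ∑ _l' : Fin d, (M + M) := by
    apply le_antisymm (Finset.sum_le_sum fun l' _ => add_le_add (hnb l').1 (hnb l').2)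
    rw [← hharm, hfx, Finset.sum_const, Finset.card_univ, Fintype.card_fin, nsmul_eq_mul]; linarith
  have hall := (Finset.sum_eq_sum_iff_of_le fun l' _ => add_le_add (hnb l').1 (hnb l').2).1 hsum l (mem_univ l)
  constructor <;> linarith [(hnb l).1, (hnb l).2]

/-- **Discrete maximum principle.** Let `d ≥ 1`, `I` a finite set of sites and `f` lattice-harmonic at every point of
`I` (`2d·f(x) = Σ_λ (f(x+e_λ) + f(x−e_λ))`). Then every value of `f` on `I` is bounded above by a value on `layer I`. -/
theorem exists_mem_layer_le_of_harmonic (hd : 0 < d) {f : Site d → ℝ} {I : Finset (Site d)}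
    (hharm : ∀ x ∈ I, 2 * (d : ℝ) * f x = ∑ l : Fin d, (f (x + e l) + f (x - e l))) {x : Site d} (hx : x ∈ I) :
    ∃ y ∈ layer I, f x ≤ f y := by
  classical
  -- a maximiser of `f` on the finite set `I ∪ layer I`
  obtain ⟨z, hz, hzmax⟩ := Finset.exists_max_image (I ∪ layer I) f ⟨x, mem_union_left _ hx⟩
  rcases mem_union.1 hz with hzI | hzL
  swap
  · exact ⟨z, hzL, hzmax x (mem_union_left _ hx)⟩
  -- walk from `z` in direction `e₀` until leaving `I`
  set l₀ : Fin d := ⟨0, hd⟩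
  let w : ℕ → Site d := fun n => z + (n : ℤ) • e l₀
  have hw0 : w 0 = z := by simp [w]
  have hwsucc : ∀ n, w (n + 1) = w n + e l₀ := by
    intro n; simp only [w]; push_cast; rw [add_smul, one_smul, add_assoc]
  -- the walk is injective, `I` is finite: some `w n ∉ I`
  have hinj : Function.Injective w := by
    intro m n hmn
    have h : ((m : ℤ) - n) • e l₀ = 0 := by
      have h' : (m : ℤ) • e l₀ = (n : ℤ) • e l₀ := add_left_cancel hmn
      rw [sub_smul, h', sub_self]
    rcases smul_eq_zero.1 h with h | h
    · exact_mod_cast sub_eq_zero.1 h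
    · exact absurd h (e_ne_zero l₀)
  have hex : ∃ n, w n ∉ I := by
    by_contra hall
    push Not at hall
    have hfin : (Set.range w).Finite := I.finite_toSet.subset (by rintro _ ⟨n, rfl⟩; exact hall n)
    exact Set.infinite_range_of_injective hinj hfin
  let n₀ := Nat.find hex
  have hn₀ : w n₀ ∉ I := Nat.find_spec hex
  have hpos : 0 < n₀ := by
    rw [Nat.pos_iff_ne_zero]; intro h0
    apply hn₀
    have : w n₀ = z := by simp only [n₀] at h0 ⊢; rw [h0, hw0]
    rw [this]; exact hzI
  -- all earlier points are in `I` with value `f z`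
  have hval : ∀ n, n < n₀ → w n ∈ I ∧ f (w n) = f z := by
    intro n
    induction n with
    | zero => intro _; exact ⟨by rw [hw0]; exact hzI, by rw [hw0]⟩
    | succ k ih =>
      intro hk
      have hkI : w (k + 1) ∈ I := by
        by_contra hc; exact Nat.find_min hex hk hc
      obtain ⟨hkI', hfk⟩ := ih (Nat.lt_of_succ_lt hk)
      refine ⟨hkI, ?_⟩
      rw [hwsucc]
      exact (eq_of_harmonic_max hkI' (hharm _ hkI') hzmax hfk l₀).1
  obtain ⟨m, hm⟩ : ∃ m, n₀ = m + 1 := Nat.exists_eq_succ_of_ne_zero hpos.ne'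
  obtain ⟨hmI, hfm⟩ := hval m (by omega)
  have hmsucc : w (m + 1) ∉ I := by rw [← hm]; exact hn₀
  have hlayer : w (m + 1) ∈ layer I := by
    rw [hwsucc]; exact (mem_layer_of_not_mem hmI l₀).1 (by rw [← hwsucc]; exact hmsucc)
  have hfn : f (w (m + 1)) = f z := by
    rw [hwsucc]; exact (eq_of_harmonic_max hmI (hharm _ hmI) hzmax hfm l₀).1
  exact ⟨w (m + 1), hlayer, by rw [hfn]; exact hzmax x (mem_union_left _ hx)⟩

/-! ## §4 The rung -/

/-- **THE ABELIAN DIRICHLET RUNG (ROUTES-NE7b v4 §2 (2b)).** Let `d ≥ 1`, `A` a real link field on `ℤ^d`, `(μ, ν)` an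
orientation and `I` a finite set of sites such that for every `x ∈ I` the Euler–Lagrange equations `δF = 0` hold on the
four links of the plaquette `(x; μ, ν)` (e.g. all four links are free links of a Dirichlet minimiser,
`codiff_eq_zero_of_isMinOn`). Then `F_{μν}` is lattice-harmonic on `I` and for every `x ∈ I` there is a site `y` in the
outer layer of `I` with `F_{μν}(x) ≤ F_{μν}(y)`. -/
theorem abelianDirichletRung (hd : 0 < d) (A : ZdEdge d → ℝ) (μ ν : Fin d) (I : Finset (Site d))
    (hEL : ∀ x ∈ I, codiff A x μ = 0 ∧ codiff A (x + e μ) ν = 0 ∧ codiff A (x + e ν) μ = 0 ∧ codiff A x ν = 0)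
    {x : Site d} (hx : x ∈ I) : ∃ y ∈ layer I, curv A x μ ν ≤ curv A y μ ν :=
  exists_mem_layer_le_of_harmonic hd
    (fun z hz => meanValue_curv A z μ ν (hEL z hz).1 (hEL z hz).2.1 (hEL z hz).2.2.1 (hEL z hz).2.2.2) hx

/-- **THE RUNG, ABSOLUTE VALUES: NO OVERSHOOT.** Under the same hypotheses, `∀ x ∈ I, ∃ y ∈ layer I,
|F_{μν}(x)| ≤ |F_{μν}(y)|`: the curvature on the free plaquettes never exceeds the largest curvature on the
one-plaquette collar — constant exactly `1`, uniformly in `I`. -/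
theorem abelianDirichletRung_abs (hd : 0 < d) (A : ZdEdge d → ℝ) (μ ν : Fin d) (I : Finset (Site d))
    (hEL : ∀ x ∈ I, codiff A x μ = 0 ∧ codiff A (x + e μ) ν = 0 ∧ codiff A (x + e ν) μ = 0 ∧ codiff A x ν = 0)
    {x : Site d} (hx : x ∈ I) : ∃ y ∈ layer I, |curv A x μ ν| ≤ |curv A y μ ν| := by
  by_cases hsign : 0 ≤ curv A x μ ν
  · obtain ⟨y, hy, hle⟩ := abelianDirichletRung hd A μ ν I hEL hx
    exact ⟨y, hy, by rw [abs_of_nonneg hsign]; exact hle.trans (le_abs_self _)⟩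
  · -- apply the maximum principle to `F_{νμ} = −F_{μν}`
    have hEL' : ∀ z ∈ I, codiff A z ν = 0 ∧ codiff A (z + e ν) μ = 0 ∧ codiff A (z + e μ) ν = 0 ∧ codiff A z μ = 0 :=
      fun z hz => ⟨(hEL z hz).2.2.2, (hEL z hz).2.2.1, (hEL z hz).2.1, (hEL z hz).1⟩
    obtain ⟨y, hy, hle⟩ := abelianDirichletRung hd A ν μ I hEL' hx
    refine ⟨y, hy, ?_⟩
    rw [curv_swap, curv_swap A y] at hle
    rw [abs_of_neg (not_le.1 hsign)]
    exact hle.trans (neg_le_abs _)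

/-! ## §5 The rung for a Dirichlet problem: free links, free plaquettes, the certified collar -/

/-- The FREE PLAQUETTES of orientation `(μ, ν)` of a finite set `free` of links: the sites `x` all four of whose links
`(x,μ), (x+e_μ,ν), (x+e_ν,μ), (x,ν)` are free (v4's `I`). -/
def freePlaq (free : Finset (ZdEdge d)) (μ ν : Fin d) : Finset (Site d) :=
  (free.image Prod.fst).filter fun x => (x, μ) ∈ free ∧ (x + e μ, ν) ∈ free ∧ (x + e ν, μ) ∈ free ∧ (x, ν) ∈ free

/-- Membership in `freePlaq`. -/
theorem mem_freePlaq_iff (free : Finset (ZdEdge d)) (μ ν : Fin d) (x : Site d) :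
    x ∈ freePlaq free μ ν ↔ (x, μ) ∈ free ∧ (x + e μ, ν) ∈ free ∧ (x + e ν, μ) ∈ free ∧ (x, ν) ∈ free := by
  simp only [freePlaq, mem_filter, mem_image, Prod.exists, exists_and_right, exists_eq_right, and_iff_right_iff_imp]
  exact fun h => ⟨μ, h.1⟩

/-- A site of the outer layer of the free plaquettes labels a plaquette with at least one FROZEN link (v4's `∂I`: «each
touches a frozen link» — in the Dirichlet toy its curvature is read off certified data). -/
theorem exists_not_mem_free_of_mem_layer (free : Finset (ZdEdge d)) (μ ν : Fin d) {y : Site d}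
    (hy : y ∈ layer (freePlaq free μ ν)) :
    ¬ ((y, μ) ∈ free ∧ (y + e μ, ν) ∈ free ∧ (y + e ν, μ) ∈ free ∧ (y, ν) ∈ free) := by
  intro h
  have hyI : y ∉ freePlaq free μ ν := (mem_sdiff.1 hy).2
  exact hyI ((mem_freePlaq_iff free μ ν y).2 h)

/-- **THE RUNG FOR THE DIRICHLET TOY (v4 (2b) verbatim).** Let `d ≥ 1`, `free` a finite set of links of `ℤ^d` and `A` a
real link field satisfying the Euler–Lagrange equations `(δ dA)(b) = 0` on every free link `b` (a critical point — in
particular a minimiser — of the Dirichlet energy with the non-free links frozen, `codiff_eq_zero_of_isMinOn`). Then for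
every orientation `(μ, ν)` and every free plaquette `x ∈ I := freePlaq free μ ν` there is `y` in the outer layer `∂I`,
labelling a plaquette with a frozen link, such that `|F_{μν}(x)| ≤ |F_{μν}(y)|`: `max_I |F_{μν}| ≤ max_{∂I} |F_{μν}|`,
constant `1`, uniformly in `free`. -/
theorem abelianDirichletRung_free (hd : 0 < d) (free : Finset (ZdEdge d)) (A : ZdEdge d → ℝ)
    (hcrit : ∀ (y : Site d) (κ : Fin d), (y, κ) ∈ free → codiff A y κ = 0) (μ ν : Fin d) {x : Site d}
    (hx : x ∈ freePlaq free μ ν) :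
    ∃ y ∈ layer (freePlaq free μ ν),
      ¬ ((y, μ) ∈ free ∧ (y + e μ, ν) ∈ free ∧ (y + e ν, μ) ∈ free ∧ (y, ν) ∈ free) ∧
        |curv A x μ ν| ≤ |curv A y μ ν| := by
  have hEL : ∀ z ∈ freePlaq free μ ν,
      codiff A z μ = 0 ∧ codiff A (z + e μ) ν = 0 ∧ codiff A (z + e ν) μ = 0 ∧ codiff A z ν = 0 := by
    intro z hz
    obtain ⟨h1, h2, h3, h4⟩ := (mem_freePlaq_iff free μ ν z).1 hz
    exact ⟨hcrit z μ h1, hcrit (z + e μ) ν h2, hcrit (z + e ν) μ h3, hcrit z ν h4⟩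
  obtain ⟨y, hy, hle⟩ := abelianDirichletRung_abs hd A μ ν (freePlaq free μ ν) hEL hx
  exact ⟨y, hy, exists_not_mem_free_of_mem_layer free μ ν hy, hle⟩

end Summit.QuantumFields.BalabanUV.T4Continuum.NE7b.AbelianCurvatureMaximumPrinciple
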